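/-
Copyright (c) 2026 the pub-hodgecm-mathlib formalisation cell (harness21).  Prover seat hodgecm-mathlib-K2E3-p11 (g4),
Track B «K2-LIT» ∕ h413 (`stmt-HodgeConjecture-24833`), line `K2_E3_EllipticInputs`, unit U12 §L ∕ row #11, kernel road «RICHARDSON» for (L-B_GL)
(`sig_K2E3GLnNilpotentFourierRegular`, all `N`), brick (R3) «SUBSPACE FOURIER FOR A NILPOTENT BLOCK»: `∫_𝔫 𝓕f = c · ∫_𝔭 f`.  2026-09-04.
-/
import Summits.HodgeConjecture.HodgeConjecture.Theorems.K2E3GLnMaximalParabolicDescent   -- ★ p857137 (this seat) K1: `exists_continuousLinearEquiv_entries`, `locallyCompactSpace_matrix`, `secondCountableTopology_matrix`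
import Literature.NumberTheory.Automorphic.LocalPiSchwartzBruhatFourier                    -- ★ `piFourierSB`, `piFourierSB_piFourierSB_eq`, `piFourierSB_eq_zero_of_notMem`, `exists_forall_add_eq_of_mem_schwartzBruhat_pi`
import Mathlib.MeasureTheory.Measure.Haar.Unique
import Mathlib.MeasureTheory.Integral.Prod
import HarnessLib

/-!
# K2_E3 road (h413), §L ∕ row #11 — kernel road «RICHARDSON» for (L-B_GL), brick (R3): SUBSPACE FOURIER FOR A NILPOTENT BLOCK of `𝔤𝔩(m ⊕ n)`

Cell `pub/hodgecm-mathlib` (D-0151), Track B (21-frontier RULING «PUSH BOTH» 2026-09-03, director req624), seat K2E3-p11 (g4); announced on the squad bus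
2026-09-04T04:00Z (MEMO «ROW 11 — SPLIT ROAD» v1 §4–§5, `K2/K2E3-p11/g4/MEMO-ROW11-SplitRoad.v1.K2E3-p11-g4.md`).  `--supports stmt-HodgeConjecture-24833 --as helper`;
THEOREMS ONLY (no definition ∕ instance ∕ notation ∕ named fact ∕ `sorry`); never imports `Cruxes/…/Lines`.  COUNT-NEUTRAL: (L-B_GL) `sig_K2E3GLnNilpotentFourierRegular`
and its residual leaves (LBGL-2b), (LBGL-ge3) stay OPEN; this brick is the Fourier half of the Richardson road (every nilpotent orbit of `𝔤𝔩_N` is Richardson, so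
`μ_𝒪 = c · Λ_P`, `Λ_P(f) = ∫_K ∫_{𝔫_P} f(Ad(k) n) dn dk`, and `Λ_P(𝓕f) = c′ ∫_K ∫_{𝔭} f(Ad(k) p) dp dk` by THIS file applied inside the `K`-integral; then ★ K1's Lie
form turns `∫_𝔭` into the Lie-algebra van Dijk ∕ KMU measure from `𝔩`).

THE MATHEMATICS ([HarishChandra1999AdmissibleDistributions, §§3–4, §7]; [Howe1974, Prop. 3]; the Fourier analysis is [WeilBNT1967, Ch. VII §2]).  Let `F` be a
non-archimedean local field of characteristic `0`, `ψ` a continuous non-trivial additive character, `𝔤 = 𝔤𝔩(m ⊕ n, F)` in block form, `𝔫 = {ι(X) = [[0, X],[0, 0]]}`,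
`𝔭 = {[[A, C],[0, B]]}`, `𝓕_ψ f(Y) = ∫_𝔤 ψ(tr(Y Z)) f(Z) dμ𝔤(Z)` the matrix Fourier transform of the §L sockets.  Since `tr(ι(X) · Z) = tr(X · Z₂₁)` (§1), the trace form pairs
`𝔫` perfectly with the OPPOSITE block `𝔫⁻ = {Z₂₁}` and annihilates `𝔭 = (𝔫⁻)^⊥`; Fourier inversion at `0` on `𝔫⁻ ≅ F^{n×m}` (§2: `∫ Φ̂ dμ = c_ψ(μ) · Φ(0)`, from ★
`piFourierSB_piFourierSB_eq`) therefore gives, for every `f ∈ C_c^∞(𝔤)` (locally constant, compact support),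

  **`∫_{M_{m×n}(F)} 𝓕_ψ f(ι X) dμX(X) = c · ∫ f([[A, C],[0, B]]) d(μA ⊗ μX ⊗ μB)(A, C, B)`**   (`integral_matrixFourier_nilBlock_eq`, §4)

with ONE constant `c > 0` depending only on the Haar measures `μ𝔤, μX, μA, μB` and on `ψ` (§4 gives it in closed form: the Haar-uniqueness factor of `μ𝔤` against the
block product measure, times Weil's self-duality constant of the transported `μX` on `F^{n×m}`).  The `X`-integral is an honest Bochner integral of the Schwartz–Bruhat
function `X ↦ 𝓕f(ιX)`; the proof is Haar uniqueness on `𝔤 ≅ (𝔪 × M_{m×n} × 𝔪′) × F^{n×m}` (§3), Fubini twice (the second time for the continuous compactly supported kernel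
`(X, w) ↦ Φ̂_w(X)`, whose compact support in `X` is UNIFORM in the `𝔭`-coordinate `w` by the uniform lattice of `f`, §3 `exists_forall_add_eq_of_entries_mem`), and §2.
NOT here: the `K`-average (the consumer's `∫_K`, ★ p856815 `integral_comp_conj_of_mem_glInt`), non-maximal parabolics (in stages), the reindexing `m ⊕ n ≃ Fin N`.

References: [HarishChandra1999AdmissibleDistributions] Harish-Chandra (DeBacker–Sally), *Admissible invariant distributions on reductive p-adic groups*, ULECT 16 (1999),
§3 (nilpotent distributions), Thm. 4.4, §7 (parabolic descent of the Fourier transform) · [Howe1974] R. Howe, *The Fourier transform and germs of characters*, Math. Ann.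
208 (1974), Prop. 3 · [WeilBNT1967] A. Weil, *Basic Number Theory*, Ch. VII §2 Prop. 2, Cor. 1 (Fourier transform on `𝒮(F^n)`, self-dual constant), Ch. I §2.
HONEST LABEL: HC_CM is proved only modulo the 7 printed citations (2 remaining named inputs: hLiu418 = stmt-HodgeConjecture-24832, h413 = stmt-HodgeConjecture-24833)
until rung 0 closes; count-neutral helper.
-/

set_option autoImplicit false
set_option linter.dupNamespace false   -- `Summit.HodgeConjecture.HodgeConjecture.…` (D-0017 nested layout; lakefile exemption for Summits)

noncomputable section

open MeasureTheory MeasureTheory.Measure Matrix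
open scoped ENNReal NNReal
open Literature.NumberTheory.Automorphic
open Literature.NumberTheory.GaloisRepresentations Literature.NumberTheory.GaloisRepresentations.IsNonarchimedeanLocalField
open Summit.HodgeConjecture.HodgeConjecture.Cruxes.H413.K2E3GLnMaximalParabolicDescent

namespace Summit.HodgeConjecture.HodgeConjecture.Cruxes.H413.K2E3GLnNilBlockSubspaceFourier

/-! ## §1  The trace form pairs `𝔫` with the opposite block: `tr(ι(X) · Z) = tr(X · Z₂₁) = ⟨entries of Z₂₁, entries of Xᵀ⟩` -/

section Algebra

variable {R : Type*} [CommRing R] {m n : Type*} [Fintype m] [Fintype n]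

/-- `tr [[A, B],[C, D]] = tr A + tr D`. [folklore] -/
theorem trace_fromBlocks_eq (A : Matrix m m R) (B : Matrix m n R) (C : Matrix n m R) (D : Matrix n n R) :
    Matrix.trace (fromBlocks A B C D) = Matrix.trace A + Matrix.trace D := by
  simp [Matrix.trace, Fintype.sum_sum_type]

/-- **`tr(ι(X) · Z) = tr(X · Z₂₁)`**: the trace form pairs the nilpotent block `𝔫 = {[[0,X],[0,0]]}` with the opposite block `Z₂₁` only (so `𝔫^⊥ = 𝔭`).
[cite: HarishChandra1999AdmissibleDistributions, §7] -/
theorem trace_nilBlock_mul (X : Matrix m n R) (Z : Matrix (m ⊕ n) (m ⊕ n) R) :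
    Matrix.trace (fromBlocks (0 : Matrix m m R) X 0 (0 : Matrix n n R) * Z) = Matrix.trace (X * Z.toBlocks₂₁) := by
  conv_lhs => rw [← fromBlocks_toBlocks Z]
  rw [fromBlocks_multiply, trace_fromBlocks_eq]
  simp

/-- `tr(X · D) = Σ_{(j,i)} D j i · X i j` — the trace pairing `M_{m×n} × M_{n×m} → R` is the dot product of the entry vectors indexed by `n × m`. [folklore] -/
theorem trace_mul_eq_dotProduct (X : Matrix m n R) (D : Matrix n m R) :
    Matrix.trace (X * D) = (fun p : n × m => D p.1 p.2) ⬝ᵥ (fun p : n × m => X p.2 p.1) := by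
  simp only [Matrix.trace, Matrix.diag, Matrix.mul_apply, dotProduct, Fintype.sum_prod_type]
  rw [Finset.sum_comm]
  refine Finset.sum_congr rfl fun j _ => Finset.sum_congr rfl fun i _ => ?_
  ring

end Algebra

/-! ## §2  Fourier inversion at the origin on `F^ι`: `∫ Φ̂ dμ = c_ψ(μ) · Φ(0)` -/

section FourierAtZero

variable {F : Type*} [Field F] [ValuativeRel F] [TopologicalSpace F] [IsNonarchimedeanLocalField F]
  {ι : Type*} [Fintype ι] [MeasurableSpace (ι → F)] [BorelSpace (ι → F)]

/-- **Fourier inversion at `0`**: for a Haar measure `μ` on `F^ι`, `ψ` continuous non-trivial of conductor exponent `m`, and `Φ ∈ 𝒮(F^ι)`,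
`∫ Φ̂ dμ = c · Φ(0)` with `c = piSelfDualConst F ι μ m = μ(𝒪^ι) μ((𝔭^m)^ι) > 0` — the value at `η = 0` of ★ `(Φ̂)̂ = c · Φ(-·)`.
[cite: WeilBNT1967, Ch. VII §2 Cor. 1] -/
theorem integral_piFourierSB_eq_const_mul_apply_zero (μ : Measure (ι → F)) [μ.IsAddHaarMeasure]
    {ψ : AddChar F Circle} (hψ : ψ.IsContinuousNontrivial) {m : ℤ} (hm : ψ.HasConductorExp m)
    {Φ : (ι → F) → ℂ} (hΦ : Φ ∈ SchwartzBruhat (ι → F)) :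
    ∫ η, piFourierSB ψ μ Φ η ∂μ = (piSelfDualConst F ι μ m : ℂ) * Φ 0 := by
  have h := congrFun (piFourierSB_piFourierSB_eq μ hψ hm hΦ) 0
  rw [piFourierSB_apply] at h
  simp only [dotProduct_zero, AddChar.map_zero_eq_one, Circle.coe_one, one_mul, neg_zero] at h
  exact h

end FourierAtZero

/-! ## §3  Plumbing on `𝔤𝔩(m ⊕ n)`: the swapped entry trivialisation of `M_{m×n}`, the uniform lattice of a test function -/

section Plumbing

variable {F : Type*} [Field F] [TopologicalSpace F] {m n : Type*}

/-- The SWAPPED entry trivialisation `X ↦ ((j, i) ↦ X i j) : M_{m×n}(F) ≃L[F] (n × m → F)` (so that `tr(X · D)` is the dot product of the entry vectors of `D` and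
of `X` under this map, `trace_mul_eq_dotProduct`). [cite: WeilBNT1967, Ch. I §2 Cor. 1 of Thm. 3] -/
theorem exists_continuousLinearEquiv_entries_swap [IsTopologicalRing F] :
    ∃ e : Matrix m n F ≃L[F] (n × m → F), ∀ X (p : n × m), e X p = X p.2 p.1 := by
  refine ⟨ContinuousLinearEquiv.mk
    { toFun := fun X p => X p.2 p.1
      invFun := fun c => Matrix.of fun i j => c (j, i)
      map_add' := fun X Y => rfl
      map_smul' := fun a X => rfl
      left_inv := fun X => by ext i j; rfl
      right_inv := fun c => by funext p; rfl } ?_ ?_, fun X p => rfl⟩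
  · change Continuous fun X : Matrix m n F => fun p : n × m => X p.2 p.1
    exact continuous_pi fun p => (continuous_apply p.1).comp (continuous_apply p.2)
  · change Continuous fun c : n × m → F => Matrix.of fun i j => c (j, i)
    exact continuous_matrix fun i j => continuous_apply _

variable [ValuativeRel F] [IsNonarchimedeanLocalField F] [Fintype m] [Fintype n]

/-- **Uniform lattice of a test function on a matrix space**: a locally constant compactly supported `f : M_{m×n}(F) → ℂ` is invariant under translation by every
matrix with all entries in `𝔭^N`, for one `N` (★ `exists_forall_add_eq_of_mem_schwartzBruhat_pi` transported along the entry trivialisation).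
[cite: WeilBNT1967, Ch. VII §2 Prop. 2] -/
theorem exists_forall_add_eq_of_entries_mem {f : Matrix m n F → ℂ} (hf : IsLocallyConstant f) (hfc : HasCompactSupport f) :
    ∃ N : ℤ, ∀ Z T : Matrix m n F, (∀ i j, T i j ∈ primePowBall F N) → f (Z + T) = f Z := by
  haveI : IsTopologicalRing F := inferInstance
  obtain ⟨e, he⟩ := exists_continuousLinearEquiv_entries (F := F) (m := m) (n := n)
  have hΦ : (f ∘ e.symm) ∈ SchwartzBruhat (m × n → F) := by
    rw [mem_schwartzBruhat_iff]
    exact ⟨hf.comp_continuous e.symm.continuous, hfc.comp_homeomorph e.symm.toHomeomorph⟩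
  obtain ⟨N, hN⟩ := exists_forall_add_eq_of_mem_schwartzBruhat_pi hΦ
  refine ⟨N, fun Z T hT => ?_⟩
  have hT' : e T ∈ piPrimePowBall F (m × n) N := by
    rw [mem_piPrimePowBall_iff]
    intro p
    rw [he]
    exact hT p.1 p.2
  have h := hN (e Z) (e T) hT'
  simp only [Function.comp_apply, ← map_add, ContinuousLinearEquiv.symm_apply_apply] at h
  exact h

omit [Fintype m] [Fintype n] in
/-- Entries of `[[0, 0],[T, 0]]` lie in `𝔭^N` when those of `T` do. [folklore] -/
theorem fromBlocks_zero_entries_mem (N : ℤ) (T : Matrix n m F) (hT : ∀ i j, T i j ∈ primePowBall F N) :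
    ∀ i j, (fromBlocks (0 : Matrix m m F) (0 : Matrix m n F) T (0 : Matrix n n F)) i j ∈ primePowBall F N := by
  rintro (i | i) (j | j)
  · simpa using zero_mem_primePowBall N
  · simpa using zero_mem_primePowBall N
  · simpa using hT i j
  · simpa using zero_mem_primePowBall N

end Plumbing

/-! ## §4  The theorem: `∫_{M_{m×n}} 𝓕_ψ f(ι X) dμX = c · ∫ f([[A, C],[0, B]]) d(μA ⊗ μX ⊗ μB)` -/

section Main

variable {F : Type*} [Field F] [ValuativeRel F] [TopologicalSpace F] [IsNonarchimedeanLocalField F]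
  {m n : Type*} [Fintype m] [Fintype n]
  [MeasurableSpace (Matrix (m ⊕ n) (m ⊕ n) F)] [BorelSpace (Matrix (m ⊕ n) (m ⊕ n) F)]
  [MeasurableSpace (Matrix m n F)] [BorelSpace (Matrix m n F)]
  [MeasurableSpace (Matrix m m F)] [BorelSpace (Matrix m m F)]
  [MeasurableSpace (Matrix n n F)] [BorelSpace (Matrix n n F)]

/-- **SUBSPACE FOURIER FOR A NILPOTENT BLOCK (brick (R3) of the Richardson road).**  `F` a non-archimedean local field (char. 0), `ψ` a continuous non-trivial additive
character, `μ𝔤` an additive Haar measure on `𝔤 = 𝔤𝔩(m ⊕ n, F)`, `μX` one on `M_{m×n}(F)`, `μA`, `μB` ones on `M_m(F)`, `M_n(F)`.  There is ONE constant `c > 0` such that for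
every locally constant compactly supported `f : 𝔤 → ℂ`,
`∫_{M_{m×n}} (∫_𝔤 ψ(tr(ι(X) Z)) f(Z) dμ𝔤(Z)) dμX(X) = c · ∫ f([[A, C],[0, B]]) d((μA ⊗ μX) ⊗ μB)(A, C, B)`, `ι(X) = [[0, X],[0, 0]]`:
the Fourier transform of (Lebesgue measure on) the nilpotent block `𝔫` is (Lebesgue measure on) its trace-annihilator `𝔭 = 𝔫^⊥ ⊋ 𝔫`.
[cite: HarishChandra1999AdmissibleDistributions, §7, Thm. 4.4] [cite: Howe1974, Prop. 3] [cite: WeilBNT1967, Ch. VII §2 Cor. 1] -/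
theorem integral_matrixFourier_nilBlock_eq (ψ : AddChar F Circle) (hψ : ψ.IsContinuousNontrivial)
    (μ𝔤 : Measure (Matrix (m ⊕ n) (m ⊕ n) F)) [μ𝔤.IsAddHaarMeasure] (μX : Measure (Matrix m n F)) [μX.IsAddHaarMeasure]
    (μA : Measure (Matrix m m F)) [μA.IsAddHaarMeasure] (μB : Measure (Matrix n n F)) [μB.IsAddHaarMeasure] :
    ∃ c : ℝ, 0 < c ∧ ∀ f : Matrix (m ⊕ n) (m ⊕ n) F → ℂ, IsLocallyConstant f → HasCompactSupport f →
      ∫ X, (∫ Z, ((ψ (Matrix.trace (fromBlocks (0 : Matrix m m F) X 0 (0 : Matrix n n F) * Z)) : Circle) : ℂ) * f Z ∂μ𝔤) ∂μX =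
        (c : ℂ) * ∫ p : (Matrix m m F × Matrix m n F) × Matrix n n F, f (fromBlocks p.1.1 p.1.2 0 p.2) ∂((μA.prod μX).prod μB) := by
  -- §a instances
  haveI : T2Space F := (isLocalField F).toT2Space
  haveI : LocallyCompactSpace F := (isLocalField F).toLocallyCompactSpace
  haveI : SecondCountableTopology F := secondCountableTopology_localField F
  haveI : IsTopologicalRing F := inferInstance
  haveI : LocallyCompactSpace (Matrix (m ⊕ n) (m ⊕ n) F) := locallyCompactSpace_matrix
  haveI : SecondCountableTopology (Matrix (m ⊕ n) (m ⊕ n) F) := secondCountableTopology_matrix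
  haveI : LocallyCompactSpace (Matrix m n F) := locallyCompactSpace_matrix
  haveI : SecondCountableTopology (Matrix m n F) := secondCountableTopology_matrix
  haveI : LocallyCompactSpace (Matrix m m F) := locallyCompactSpace_matrix
  haveI : SecondCountableTopology (Matrix m m F) := secondCountableTopology_matrix
  haveI : LocallyCompactSpace (Matrix n n F) := locallyCompactSpace_matrix
  haveI : SecondCountableTopology (Matrix n n F) := secondCountableTopology_matrix
  letI : MeasurableSpace (n × m → F) := borel _
  haveI : BorelSpace (n × m → F) := ⟨rfl⟩
  obtain ⟨mψ, hm⟩ := hψ.exists_hasConductorExp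
  -- §b the entry trivialisations of the two off-diagonal blocks
  obtain ⟨e₁, he₁⟩ := exists_continuousLinearEquiv_entries (F := F) (m := n) (n := m)
  obtain ⟨e₂, he₂⟩ := exists_continuousLinearEquiv_entries_swap (F := F) (m := m) (n := n)
  have he₁v : ∀ v : n × m → F, (fun p : n × m => (e₁.symm v) p.1 p.2) = v := fun v => by
    funext p
    have h := he₁ (e₁.symm v) p
    rw [ContinuousLinearEquiv.apply_symm_apply] at h
    exact h.symm
  have he₂X : ∀ X : Matrix m n F, (fun p : n × m => X p.2 p.1) = e₂ X := fun X => by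
    funext p; rw [he₂]
  -- §c the block decomposition `Ψ : 𝔤 ≃ₜ+ W × V`, `W = (M_m × M_{m×n}) × M_n`, `V = F^{n×m}`
  obtain ⟨Ψ, hΨs⟩ : ∃ Ψ : Matrix (m ⊕ n) (m ⊕ n) F ≃ₜ+ ((Matrix m m F × Matrix m n F) × Matrix n n F) × (n × m → F),
      ∀ (w : (Matrix m m F × Matrix m n F) × Matrix n n F) (v : n × m → F), Ψ.symm (w, v) = fromBlocks w.1.1 w.1.2 (e₁.symm v) w.2 := by
    refine ⟨{ toFun := fun Z => (((Z.toBlocks₁₁, Z.toBlocks₁₂), Z.toBlocks₂₂), e₁ Z.toBlocks₂₁)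
              invFun := fun q => fromBlocks q.1.1.1 q.1.1.2 (e₁.symm q.2) q.1.2
              left_inv := fun Z => by simp [fromBlocks_toBlocks]
              right_inv := fun q => by simp
              map_add' := fun Z Z' => by
                refine Prod.ext (Prod.ext (Prod.ext rfl rfl) rfl) ?_
                change e₁ (Z + Z').toBlocks₂₁ = e₁ Z.toBlocks₂₁ + e₁ Z'.toBlocks₂₁
                rw [← map_add]; rfl
              continuous_toFun := ?_
              continuous_invFun := ?_ }, fun w v => rfl⟩
    · change Continuous fun Z : Matrix (m ⊕ n) (m ⊕ n) F => (((Z.toBlocks₁₁, Z.toBlocks₁₂), Z.toBlocks₂₂), e₁ Z.toBlocks₂₁)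
      have h11 : Continuous fun Z : Matrix (m ⊕ n) (m ⊕ n) F => Z.toBlocks₁₁ :=
        continuous_matrix fun i j =>
          show Continuous (fun Z : Matrix (m ⊕ n) (m ⊕ n) F => Z (Sum.inl i) (Sum.inl j)) from
            (continuous_apply (Sum.inl j)).comp (continuous_apply (Sum.inl i))
      have h12 : Continuous fun Z : Matrix (m ⊕ n) (m ⊕ n) F => Z.toBlocks₁₂ :=
        continuous_matrix fun i j =>
          show Continuous (fun Z : Matrix (m ⊕ n) (m ⊕ n) F => Z (Sum.inl i) (Sum.inr j)) from
            (continuous_apply (Sum.inr j)).comp (continuous_apply (Sum.inl i))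
      have h21 : Continuous fun Z : Matrix (m ⊕ n) (m ⊕ n) F => Z.toBlocks₂₁ :=
        continuous_matrix fun i j =>
          show Continuous (fun Z : Matrix (m ⊕ n) (m ⊕ n) F => Z (Sum.inr i) (Sum.inl j)) from
            (continuous_apply (Sum.inl j)).comp (continuous_apply (Sum.inr i))
      have h22 : Continuous fun Z : Matrix (m ⊕ n) (m ⊕ n) F => Z.toBlocks₂₂ :=
        continuous_matrix fun i j =>
          show Continuous (fun Z : Matrix (m ⊕ n) (m ⊕ n) F => Z (Sum.inr i) (Sum.inr j)) from
            (continuous_apply (Sum.inr j)).comp (continuous_apply (Sum.inr i))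
      exact ((h11.prodMk h12).prodMk h22).prodMk (e₁.continuous.comp h21)
    · change Continuous fun q : ((Matrix m m F × Matrix m n F) × Matrix n n F) × (n × m → F) => fromBlocks q.1.1.1 q.1.1.2 (e₁.symm q.2) q.1.2
      exact Continuous.matrix_fromBlocks (continuous_fst.comp (continuous_fst.comp continuous_fst))
        (continuous_snd.comp (continuous_fst.comp continuous_fst)) (e₁.symm.continuous.comp continuous_snd) (continuous_snd.comp continuous_fst)
  -- §d the transported measure `μV = (e₂)_* μX` on `V`, the product measure on `W × V`, Haar uniqueness for `μ𝔤`
  obtain ⟨μV, hμV⟩ : ∃ μV : Measure (n × m → F), μV = μX.map e₂ := ⟨_, rfl⟩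
  haveI : μV.IsAddHaarMeasure := by rw [hμV]; exact e₂.isAddHaarMeasure_map μX
  haveI : (μA.prod μX).IsAddHaarMeasure := inferInstance
  haveI : ((μA.prod μX).prod μB).IsAddHaarMeasure := inferInstance
  obtain ⟨πW, hπW⟩ : ∃ πW : Measure ((Matrix m m F × Matrix m n F) × Matrix n n F), πW = (μA.prod μX).prod μB := ⟨_, rfl⟩
  haveI : πW.IsAddHaarMeasure := by rw [hπW]; infer_instance
  haveI : SFinite πW := inferInstance
  haveI : SFinite μV := inferInstance
  haveI : MeasurableAdd ((Matrix m m F × Matrix m n F) × Matrix n n F) := inferInstance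
  haveI : MeasurableAdd (n × m → F) := inferInstance
  haveI : (πW.prod μV).IsAddHaarMeasure := inferInstance
  obtain ⟨ν, hν⟩ : ∃ ν : Measure (Matrix (m ⊕ n) (m ⊕ n) F), ν = (πW.prod μV).map Ψ.symm := ⟨_, rfl⟩
  haveI : ν.IsAddHaarMeasure := by rw [hν]; exact Ψ.symm.isAddHaarMeasure_map (πW.prod μV)
  have hμ𝔤 : μ𝔤 = μ𝔤.addHaarScalarFactor ν • ν := isAddLeftInvariant_eq_smul μ𝔤 ν
  obtain ⟨c₁, hc₁⟩ : ∃ c₁ : ℝ≥0, c₁ = μ𝔤.addHaarScalarFactor ν := ⟨_, rfl⟩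
  have hc₁pos : 0 < c₁ := by rw [hc₁]; exact addHaarScalarFactor_pos_of_isAddHaarMeasure μ𝔤 ν
  rw [← hc₁] at hμ𝔤
  have hΨm : MeasurableEmbedding (Ψ.symm : (((Matrix m m F × Matrix m n F) × Matrix n n F) × (n × m → F)) → Matrix (m ⊕ n) (m ⊕ n) F) :=
    Ψ.symm.toHomeomorph.measurableEmbedding
  have he₂m : MeasurableEmbedding (e₂ : Matrix m n F → (n × m → F)) := e₂.toHomeomorph.measurableEmbedding
  -- §e the constant
  refine ⟨(c₁ : ℝ) * piSelfDualConst F (n × m) μV mψ, mul_pos (NNReal.coe_pos.2 hc₁pos) (piSelfDualConst_pos μV), fun f hf hfc => ?_⟩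
  -- §f the uniform lattice of `f` and the compact `V`- and `W`-shadows of its support
  obtain ⟨N, hN⟩ := exists_forall_add_eq_of_entries_mem (F := F) hf hfc
  set Φ : ((Matrix m m F × Matrix m n F) × Matrix n n F) → (n × m → F) → ℂ := fun w v => f (Ψ.symm (w, v)) with hΦ
  have hΦN : ∀ w, ∀ v, ∀ t ∈ piPrimePowBall F (n × m) N, Φ w (v + t) = Φ w v := by
    intro w v t ht
    have h1 : Ψ.symm (w, v + t) = Ψ.symm (w, v) + Ψ.symm (0, t) := by
      rw [← map_add, Prod.mk_add_mk, add_zero]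
    have h2 : Ψ.symm ((0 : (Matrix m m F × Matrix m n F) × Matrix n n F), t) = fromBlocks 0 0 (e₁.symm t) 0 := by
      rw [hΨs]; rfl
    simp only [hΦ, h1, h2]
    refine hN _ _ (fromBlocks_zero_entries_mem N (e₁.symm t) fun i j => ?_)
    have := congrFun (he₁v t) (i, j)
    simp only at this
    rw [this]
    exact (mem_piPrimePowBall_iff.1 ht) (i, j)
  set SV : Set (n × m → F) := Prod.snd '' (Ψ '' tsupport f) with hSV
  have hSVc : IsCompact SV := (hfc.image Ψ.continuous).image continuous_snd
  set SW : Set ((Matrix m m F × Matrix m n F) × Matrix n n F) := Prod.fst '' (Ψ '' tsupport f) with hSW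
  have hSWc : IsCompact SW := (hfc.image Ψ.continuous).image continuous_fst
  have hΦzero : ∀ w v, (w, v) ∉ Ψ '' tsupport f → Φ w v = 0 := by
    intro w v hwv
    simp only [hΦ]
    refine image_eq_zero_of_notMem_tsupport fun h => hwv ?_
    exact ⟨Ψ.symm (w, v), h, by simp⟩
  have hΦV : ∀ w, ∀ v ∉ SV, Φ w v = 0 := fun w v hv =>
    hΦzero w v fun h => hv ⟨(w, v), h, rfl⟩
  have hΦW : ∀ w ∉ SW, ∀ v, Φ w v = 0 := fun w hw v =>
    hΦzero w v fun h => hw ⟨(w, v), h, rfl⟩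
  have hΦsb : ∀ w, Φ w ∈ SchwartzBruhat (n × m → F) := by
    intro w
    rw [mem_schwartzBruhat_iff]
    refine ⟨?_, HasCompactSupport.intro hSVc (hΦV w)⟩
    exact hf.comp_continuous (Ψ.symm.continuous.comp (Continuous.prodMk_right w))
  -- §g the integrand after the block decomposition: `ψ(tr(ι(X) Ψ⁻¹(w,v))) f(Ψ⁻¹(w,v)) = ψ(v ⬝ᵥ e₂ X) Φ w v`
  have hker : ∀ (X : Matrix m n F) (w : (Matrix m m F × Matrix m n F) × Matrix n n F) (v : n × m → F),
      ((ψ (Matrix.trace (fromBlocks (0 : Matrix m m F) X 0 (0 : Matrix n n F) * Ψ.symm (w, v))) : Circle) : ℂ) * f (Ψ.symm (w, v)) =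
        ((ψ (v ⬝ᵥ e₂ X) : Circle) : ℂ) * Φ w v := by
    intro X w v
    simp only [hΦ]
    rw [trace_nilBlock_mul, hΨs, toBlocks_fromBlocks₂₁, trace_mul_eq_dotProduct, he₁v, he₂X]
  -- §h STEP 1: the inner integral through `ν` and Fubini on `W × V`
  have hstep1 : ∀ X : Matrix m n F,
      ∫ Z, ((ψ (Matrix.trace (fromBlocks (0 : Matrix m m F) X 0 (0 : Matrix n n F) * Z)) : Circle) : ℂ) * f Z ∂μ𝔤 =
        ((c₁ : ℝ) : ℂ) * ∫ w, piFourierSB ψ μV (Φ w) (e₂ X) ∂πW := by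
    intro X
    have hcont : Continuous fun Z : Matrix (m ⊕ n) (m ⊕ n) F =>
        ((ψ (Matrix.trace (fromBlocks (0 : Matrix m m F) X 0 (0 : Matrix n n F) * Z)) : Circle) : ℂ) * f Z := by
      refine Continuous.mul ?_ hf.continuous
      refine continuous_subtype_val.comp (hψ.1.comp ?_)
      exact (continuous_id.matrix_trace).comp (continuous_const.mul continuous_id) |>.congr (fun Z => rfl)
    have hint : Integrable (fun q : ((Matrix m m F × Matrix m n F) × Matrix n n F) × (n × m → F) =>
        ((ψ (Matrix.trace (fromBlocks (0 : Matrix m m F) X 0 (0 : Matrix n n F) * Ψ.symm q)) : Circle) : ℂ) * f (Ψ.symm q)) (πW.prod μV) := by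
      refine Continuous.integrable_of_hasCompactSupport (hcont.comp Ψ.symm.continuous) ?_
      exact (hfc.comp_homeomorph Ψ.symm.toHomeomorph).mul_left
    calc ∫ Z, ((ψ (Matrix.trace (fromBlocks (0 : Matrix m m F) X 0 (0 : Matrix n n F) * Z)) : Circle) : ℂ) * f Z ∂μ𝔤
        = ∫ Z, ((ψ (Matrix.trace (fromBlocks (0 : Matrix m m F) X 0 (0 : Matrix n n F) * Z)) : Circle) : ℂ) * f Z ∂(c₁ • ν) := by
          rw [← hμ𝔤]
      _ = c₁ • ∫ Z, ((ψ (Matrix.trace (fromBlocks (0 : Matrix m m F) X 0 (0 : Matrix n n F) * Z)) : Circle) : ℂ) * f Z ∂ν :=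
          integral_smul_nnreal_measure _ c₁
      _ = ((c₁ : ℝ) : ℂ) * ∫ Z, ((ψ (Matrix.trace (fromBlocks (0 : Matrix m m F) X 0 (0 : Matrix n n F) * Z)) : Circle) : ℂ) * f Z ∂ν := by
          rw [NNReal.smul_def, Complex.real_smul]
      _ = ((c₁ : ℝ) : ℂ) * ∫ q, ((ψ (Matrix.trace (fromBlocks (0 : Matrix m m F) X 0 (0 : Matrix n n F) * Ψ.symm q)) : Circle) : ℂ) * f (Ψ.symm q) ∂(πW.prod μV) := by
          rw [hν, hΨm.integral_map]
      _ = ((c₁ : ℝ) : ℂ) * ∫ w, ∫ v, ((ψ (Matrix.trace (fromBlocks (0 : Matrix m m F) X 0 (0 : Matrix n n F) * Ψ.symm (w, v))) : Circle) : ℂ) * f (Ψ.symm (w, v)) ∂μV ∂πW := by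
          rw [integral_prod _ hint]
      _ = ((c₁ : ℝ) : ℂ) * ∫ w, piFourierSB ψ μV (Φ w) (e₂ X) ∂πW := by
          congr 1
          refine integral_congr_ae (Filter.Eventually.of_forall fun w => ?_)
          simp only [hker, piFourierSB_apply]
  -- §i STEP 2: the kernel `G(X, w) = Φ̂_w(e₂ X)` is continuous with compact support, hence Fubini in `(X, w)`
  have hGcont : Continuous (Function.uncurry fun (X : Matrix m n F) (w : (Matrix m m F × Matrix m n F) × Matrix n n F) =>
      piFourierSB ψ μV (Φ w) (e₂ X)) := by
    have hK : Continuous (Function.uncurry fun (xw : Matrix m n F × ((Matrix m m F × Matrix m n F) × Matrix n n F)) (v : n × m → F) =>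
        ((ψ (v ⬝ᵥ e₂ xw.1) : Circle) : ℂ) * Φ xw.2 v) := by
      simp only [hΦ, Function.uncurry_def]
      refine Continuous.mul ?_ ?_
      · refine continuous_subtype_val.comp (hψ.1.comp ?_)
        exact Continuous.dotProduct continuous_snd (e₂.continuous.comp (continuous_fst.comp continuous_fst))
      · exact hf.continuous.comp (Ψ.symm.continuous.comp ((continuous_snd.comp continuous_fst).prodMk continuous_snd))
    have h := continuous_parametric_integral_of_continuous (μ := μV) hK hSVc
    refine h.congr fun xw => ?_
    simp only [piFourierSB_apply]
    change ∫ v in SV, ((ψ (v ⬝ᵥ e₂ xw.1) : Circle) : ℂ) * Φ xw.2 v ∂μV = ∫ v, ((ψ (v ⬝ᵥ e₂ xw.1) : Circle) : ℂ) * Φ xw.2 v ∂μV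
    exact setIntegral_eq_integral_of_forall_compl_eq_zero fun v hv => by rw [hΦV xw.2 v hv, mul_zero]
  have hGsupp : HasCompactSupport (Function.uncurry fun (X : Matrix m n F) (w : (Matrix m m F × Matrix m n F) × Matrix n n F) =>
      piFourierSB ψ μV (Φ w) (e₂ X)) := by
    refine HasCompactSupport.intro ((e₂.toHomeomorph.isCompact_preimage.2 (isCompact_piPrimePowBall (mψ - N))).prod hSWc) ?_
    rintro ⟨X, w⟩ hXw
    simp only [Set.mem_prod, Set.mem_preimage, not_and_or] at hXw
    simp only [Function.uncurry_apply_pair]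
    rcases hXw with hX | hw
    · exact piFourierSB_eq_zero_of_notMem ψ μV hm (hΦN w) hX
    · rw [piFourierSB_apply]
      simp [hΦW w hw]
  have hGint : Integrable (Function.uncurry fun (X : Matrix m n F) (w : (Matrix m m F × Matrix m n F) × Matrix n n F) =>
      piFourierSB ψ μV (Φ w) (e₂ X)) (μX.prod πW) :=
    hGcont.integrable_of_hasCompactSupport hGsupp
  -- §j STEP 3: for each `w`, Fourier inversion at `0` on `V` (after transporting `∫ dμX` to `∫ dμV`)
  have hstep3 : ∀ w : (Matrix m m F × Matrix m n F) × Matrix n n F,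
      ∫ X, piFourierSB ψ μV (Φ w) (e₂ X) ∂μX = (piSelfDualConst F (n × m) μV mψ : ℂ) * f (fromBlocks w.1.1 w.1.2 0 w.2) := by
    intro w
    have key : ∀ G : (n × m → F) → ℂ, ∫ X, G (e₂ X) ∂μX = ∫ y, G y ∂μV := fun G => by
      rw [hμV, he₂m.integral_map]
    have h1 : ∫ X, piFourierSB ψ μV (Φ w) (e₂ X) ∂μX = ∫ y, piFourierSB ψ μV (Φ w) y ∂μV := key _
    rw [h1, integral_piFourierSB_eq_const_mul_apply_zero μV hψ hm (hΦsb w)]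
    simp only [hΦ, hΨs, map_zero]
  -- §k assembly
  calc ∫ X, (∫ Z, ((ψ (Matrix.trace (fromBlocks (0 : Matrix m m F) X 0 (0 : Matrix n n F) * Z)) : Circle) : ℂ) * f Z ∂μ𝔤) ∂μX
      = ∫ X, ((c₁ : ℝ) : ℂ) * ∫ w, piFourierSB ψ μV (Φ w) (e₂ X) ∂πW ∂μX := by
        refine integral_congr_ae (Filter.Eventually.of_forall fun X => ?_)
        exact hstep1 X
    _ = ((c₁ : ℝ) : ℂ) * ∫ X, ∫ w, piFourierSB ψ μV (Φ w) (e₂ X) ∂πW ∂μX := integral_const_mul _ _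
    _ = ((c₁ : ℝ) : ℂ) * ∫ w, ∫ X, piFourierSB ψ μV (Φ w) (e₂ X) ∂μX ∂πW := by rw [integral_integral_swap hGint]
    _ = ((c₁ : ℝ) : ℂ) * ∫ w, (piSelfDualConst F (n × m) μV mψ : ℂ) * f (fromBlocks w.1.1 w.1.2 0 w.2) ∂πW := by
        congr 1
        exact integral_congr_ae (Filter.Eventually.of_forall fun w => hstep3 w)
    _ = (((c₁ : ℝ) * piSelfDualConst F (n × m) μV mψ : ℝ) : ℂ) *
          ∫ p : (Matrix m m F × Matrix m n F) × Matrix n n F, f (fromBlocks p.1.1 p.1.2 0 p.2) ∂((μA.prod μX).prod μB) := by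
        rw [integral_const_mul, hπW, Complex.ofReal_mul, mul_assoc]

end Main

end Summit.HodgeConjecture.HodgeConjecture.Cruxes.H413.K2E3GLnNilBlockSubspaceFourier

end
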